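import Summits.ValiantsHypothesis.ValiantsHypothesis.Theorems.LacunarySymmetroidMatrixDescartesCensusTetranomialBranch

/-!
# `MatrixDescartes` census — the T4 CHORD LEMMA and CHORD ROW (upper branch)

HONEST FRAMING.  Object-search cell `pub-symmetroid`; door-A item `Theses.LacunarySymmetroid.DoorA26 = PosRootLawAt 2 6 19`
(stmt-ValiantsHypothesis-19979; OPEN, typed, never asserted).  Fourth T4 file (val-sym-door-p4 g10): with `…CensusTetranomialStaircase`
(staircase) and `…CensusTetranomialBranch` (the branch lies below its chords) this gives the CHORD rows of the T4 instrument: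

* `tetranomial_chord_upper` — if `1 − βx^a + γx^b − x^c` (`β > 0`) has three distinct positive roots and `γ(ξ₁) ≤ γ ≤ γ(ξ₂)` for upper-branch
  points `0 < ξ₁ ≤ ξ₂` (`ab ≤ (c−a)(c−b)ξ₁^c`), then `(ln β − ln β₁)(ln γ₂ − ln γ₁) ≤ (ln β₂ − ln β₁)(ln γ − ln γ₁)`;
* `tetranomial_chord_row` — hence for every real slope `σ`: `ln β − σ·ln γ ≤ max (ln β₁ − σ ln γ₁) (ln β₂ − σ ln γ₂)` — the linear row the
  instrument adds on a slab (`σ` rational, `βᵢ, γᵢ` rational in a replay).  The mirror / other-branch chords are the same statements for the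
  reversed tetranomial (`tetranomial_reverse_card`).

Proof: IVT for `γ(·)` on `[ξ₁, ξ₂]`, the staircase lemma at the branch point `ξ⋆` with `γ(ξ⋆) = γ`, `branch_below_chord`, and an affine
maximum on `[ln γ₁, ln γ₂]`.  Nothing here bears on `DoorA26`, `MatrixDescartes` (18050) or `VP ≠ VNP`.

[folklore] Elementary real analysis for one explicit curve.
-/

-- `Summit.ValiantsHypothesis.ValiantsHypothesis.…` repeats a component by the D-0017 layout
-- (single-conjunct summit), which the `dupNamespace` linter flags; the name is mandated.
set_option linter.dupNamespace false

namespace Summit.ValiantsHypothesis.ValiantsHypothesis.Theorems.LacunarySymmetroidMatrixDescartes.Census.T4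

open Polynomial Set

section Chord

variable {a b c : ℕ}

/-- **T4 CHORD LEMMA (upper branch).**  Let `0 < a < b < c`, `β > 0`, let `1 − βx^a + γx^b − x^c` have three distinct positive roots,
and let `0 < ξ₁ ≤ ξ₂` lie on the UPPER branch (`ab ≤ (c−a)(c−b)ξ₁^c`) with `γ(ξ₁) ≤ γ ≤ γ(ξ₂)`.  Then, with `βᵢ = β(ξᵢ)`,
`γᵢ = γ(ξᵢ)`: `(ln β − ln β₁)(ln γ₂ − ln γ₁) ≤ (ln β₂ − ln β₁)(ln γ − ln γ₁)` — the point `(ln γ, ln β)` lies below the chord of the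
(convex) branch.  (IVT for `γ(·)`, the staircase lemma at the branch point, `branch_below_chord`.) [this work] -/
theorem tetranomial_chord_upper (ha : 0 < a) (hab : a < b) (hbc : b < c) (β γ : ℝ) (hβ : 0 < β)
    (hZ : 3 ≤ ((C 1 - C β * X ^ a + C γ * X ^ b - X ^ c : ℝ[X]).roots.toFinset.filter (fun x => 0 < x)).card)
    (ξ₁ ξ₂ : ℝ) (hξ₁ : 0 < ξ₁) (h12 : ξ₁ ≤ ξ₂)
    (hup : (a : ℝ) * b ≤ ((c : ℝ) - a) * ((c : ℝ) - b) * ξ₁ ^ c)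
    (hγ₁ : ((a : ℝ) + ((c : ℝ) - a) * ξ₁ ^ c) / (((b : ℝ) - a) * ξ₁ ^ b) ≤ γ)
    (hγ₂ : γ ≤ ((a : ℝ) + ((c : ℝ) - a) * ξ₂ ^ c) / (((b : ℝ) - a) * ξ₂ ^ b)) :
    (Real.log β - Real.log (((b : ℝ) + ((c : ℝ) - b) * ξ₁ ^ c) / (((b : ℝ) - a) * ξ₁ ^ a)))
        * (Real.log (((a : ℝ) + ((c : ℝ) - a) * ξ₂ ^ c) / (((b : ℝ) - a) * ξ₂ ^ b))
            - Real.log (((a : ℝ) + ((c : ℝ) - a) * ξ₁ ^ c) / (((b : ℝ) - a) * ξ₁ ^ b)))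
      ≤ (Real.log (((b : ℝ) + ((c : ℝ) - b) * ξ₂ ^ c) / (((b : ℝ) - a) * ξ₂ ^ a))
            - Real.log (((b : ℝ) + ((c : ℝ) - b) * ξ₁ ^ c) / (((b : ℝ) - a) * ξ₁ ^ a)))
        * (Real.log γ - Real.log (((a : ℝ) + ((c : ℝ) - a) * ξ₁ ^ c) / (((b : ℝ) - a) * ξ₁ ^ b))) := by
  set βf : ℝ → ℝ := fun x => ((b : ℝ) + ((c : ℝ) - b) * x ^ c) / (((b : ℝ) - a) * x ^ a) with hβf
  set γf : ℝ → ℝ := fun x => ((a : ℝ) + ((c : ℝ) - a) * x ^ c) / (((b : ℝ) - a) * x ^ b) with hγf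
  show (Real.log β - Real.log (βf ξ₁)) * (Real.log (γf ξ₂) - Real.log (γf ξ₁))
      ≤ (Real.log (βf ξ₂) - Real.log (βf ξ₁)) * (Real.log γ - Real.log (γf ξ₁))
  have hb : 0 < b := ha.trans hab
  have hba : (0 : ℝ) < (b : ℝ) - a := by
    have : (a : ℝ) < b := by exact_mod_cast hab
    linarith
  have hca : (0 : ℝ) < (c : ℝ) - a := by
    have : (a : ℝ) < c := by exact_mod_cast (hab.trans hbc)
    linarith
  have hcb : (0 : ℝ) < (c : ℝ) - b := by
    have : (b : ℝ) < c := by exact_mod_cast hbc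
    linarith
  have hξ₂ : 0 < ξ₂ := lt_of_lt_of_le hξ₁ h12
  have hβfpos : ∀ x, 0 < x → 0 < βf x := fun x hx => by
    have : (0 : ℝ) < b := by exact_mod_cast hb
    exact div_pos (by positivity) (mul_pos hba (pow_pos hx _))
  have hγfpos : ∀ x, 0 < x → 0 < γf x := fun x hx => by
    have : (0 : ℝ) < a := by exact_mod_cast ha
    exact div_pos (by positivity) (mul_pos hba (pow_pos hx _))
  have hγpos : 0 < γ := lt_of_lt_of_le (hγfpos ξ₁ hξ₁) hγ₁
  -- IVT: a branch point ξ⋆ ∈ [ξ₁, ξ₂] with γ(ξ⋆) = γ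
  have hγcont : ContinuousOn γf (Icc ξ₁ ξ₂) := by
    refine ContinuousOn.div (by fun_prop) (by fun_prop) ?_
    intro x hx; exact (mul_pos hba (pow_pos (lt_of_lt_of_le hξ₁ hx.1) _)).ne'
  obtain ⟨ξs, hξs, hγs⟩ : ∃ ξs ∈ Icc ξ₁ ξ₂, γf ξs = γ := intermediate_value_Icc h12 hγcont ⟨hγ₁, hγ₂⟩
  have hξs0 : 0 < ξs := lt_of_lt_of_le hξ₁ hξs.1
  have hups : (a : ℝ) * b ≤ ((c : ℝ) - a) * ((c : ℝ) - b) * ξs ^ c := by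
    have : ξ₁ ^ c ≤ ξs ^ c := pow_le_pow_left₀ hξ₁.le hξs.1 c
    nlinarith [mul_pos hca hcb]
  -- staircase at ξ⋆: β ≤ β(ξ⋆)
  have hstair : β ≤ βf ξs :=
    tetranomial_upper_staircase_of_card ha hab hbc β γ (βf ξs) (γf ξs) ξs hZ (le_of_eq hγs.symm) hξs0
      (branch_tet_eval hab hξs0) (branch_twi_eval hab hξs0) (branch_upper_cond hab hξs0 hups)
  have hlogβ : Real.log β ≤ Real.log (βf ξs) := Real.log_le_log hβ hstair
  have hlogγ : Real.log (γf ξs) = Real.log γ := by rw [hγs]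
  -- the chord for the branch point
  have hch := branch_below_chord ha hab hbc hξ₁ hξs.1 hξs.2 hup
  change (Real.log (βf ξs) - Real.log (βf ξ₁)) * (Real.log (γf ξ₂) - Real.log (γf ξ₁))
      ≤ (Real.log (βf ξ₂) - Real.log (βf ξ₁)) * (Real.log (γf ξs) - Real.log (γf ξ₁)) at hch
  rw [hlogγ] at hch
  have hC : 0 ≤ Real.log (γf ξ₂) - Real.log (γf ξ₁) := by
    have : γf ξ₁ ≤ γf ξ₂ := hγ₁.trans hγ₂
    linarith [Real.log_le_log (hγfpos ξ₁ hξ₁) this]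
  calc (Real.log β - Real.log (βf ξ₁)) * (Real.log (γf ξ₂) - Real.log (γf ξ₁))
      ≤ (Real.log (βf ξs) - Real.log (βf ξ₁)) * (Real.log (γf ξ₂) - Real.log (γf ξ₁)) :=
        mul_le_mul_of_nonneg_right (by linarith) hC
    _ ≤ (Real.log (βf ξ₂) - Real.log (βf ξ₁)) * (Real.log γ - Real.log (γf ξ₁)) := hch

/-- **T4 CHORD ROW.**  Under the hypotheses of `tetranomial_chord_upper` with `ξ₁ < ξ₂`'s images distinct (`γ₁ < γ₂`), for EVERY real
slope `σ`: `ln β − σ ln γ ≤ max (ln β₁ − σ ln γ₁) (ln β₂ − σ ln γ₂)` — the linear row used by the T4 instrument on a slab. [this work] -/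
theorem tetranomial_chord_row (ha : 0 < a) (hab : a < b) (hbc : b < c) (β γ : ℝ) (hβ : 0 < β)
    (hZ : 3 ≤ ((C 1 - C β * X ^ a + C γ * X ^ b - X ^ c : ℝ[X]).roots.toFinset.filter (fun x => 0 < x)).card)
    (ξ₁ ξ₂ : ℝ) (hξ₁ : 0 < ξ₁) (h12 : ξ₁ ≤ ξ₂)
    (hup : (a : ℝ) * b ≤ ((c : ℝ) - a) * ((c : ℝ) - b) * ξ₁ ^ c)
    (hγ₁ : ((a : ℝ) + ((c : ℝ) - a) * ξ₁ ^ c) / (((b : ℝ) - a) * ξ₁ ^ b) ≤ γ)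
    (hγ₂ : γ ≤ ((a : ℝ) + ((c : ℝ) - a) * ξ₂ ^ c) / (((b : ℝ) - a) * ξ₂ ^ b))
    (hγ12 : ((a : ℝ) + ((c : ℝ) - a) * ξ₁ ^ c) / (((b : ℝ) - a) * ξ₁ ^ b)
        < ((a : ℝ) + ((c : ℝ) - a) * ξ₂ ^ c) / (((b : ℝ) - a) * ξ₂ ^ b)) (σ : ℝ) :
    Real.log β - σ * Real.log γ ≤
      max (Real.log (((b : ℝ) + ((c : ℝ) - b) * ξ₁ ^ c) / (((b : ℝ) - a) * ξ₁ ^ a))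
            - σ * Real.log (((a : ℝ) + ((c : ℝ) - a) * ξ₁ ^ c) / (((b : ℝ) - a) * ξ₁ ^ b)))
          (Real.log (((b : ℝ) + ((c : ℝ) - b) * ξ₂ ^ c) / (((b : ℝ) - a) * ξ₂ ^ a))
            - σ * Real.log (((a : ℝ) + ((c : ℝ) - a) * ξ₂ ^ c) / (((b : ℝ) - a) * ξ₂ ^ b))) := by
  have hch := tetranomial_chord_upper ha hab hbc β γ hβ hZ ξ₁ ξ₂ hξ₁ h12 hup hγ₁ hγ₂
  set B₁ := Real.log (((b : ℝ) + ((c : ℝ) - b) * ξ₁ ^ c) / (((b : ℝ) - a) * ξ₁ ^ a))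
  set B₂ := Real.log (((b : ℝ) + ((c : ℝ) - b) * ξ₂ ^ c) / (((b : ℝ) - a) * ξ₂ ^ a))
  set C₁ := Real.log (((a : ℝ) + ((c : ℝ) - a) * ξ₁ ^ c) / (((b : ℝ) - a) * ξ₁ ^ b))
  set C₂ := Real.log (((a : ℝ) + ((c : ℝ) - a) * ξ₂ ^ c) / (((b : ℝ) - a) * ξ₂ ^ b))
  have hba : (0 : ℝ) < (b : ℝ) - a := by
    have : (a : ℝ) < b := by exact_mod_cast hab
    linarith
  have hγ1pos : 0 < ((a : ℝ) + ((c : ℝ) - a) * ξ₁ ^ c) / (((b : ℝ) - a) * ξ₁ ^ b) := by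
    have : (0 : ℝ) < a := by exact_mod_cast ha
    have hca : (0 : ℝ) ≤ (c : ℝ) - a := by
      have : (a : ℝ) < c := by exact_mod_cast (hab.trans hbc)
      linarith
    exact div_pos (by positivity) (mul_pos hba (pow_pos hξ₁ _))
  have hC12 : C₁ < C₂ := Real.log_lt_log hγ1pos hγ12
  have hγpos : 0 < γ := lt_of_lt_of_le hγ1pos hγ₁
  have hCγ1 : C₁ ≤ Real.log γ := Real.log_le_log hγ1pos hγ₁
  have hCγ2 : Real.log γ ≤ C₂ := Real.log_le_log hγpos hγ₂
  -- ln β ≤ B₁ + s (ln γ − C₁),  s = (B₂ − B₁)/(C₂ − C₁); then an affine function of ln γ on [C₁, C₂] is ≤ its max at the ends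
  set L := Real.log γ with hL
  have hden : 0 < C₂ - C₁ := by linarith
  -- write ln γ as the convex combination (1−θ)C₁ + θC₂
  set θ := (L - C₁) / (C₂ - C₁) with hθ
  have hθ0 : 0 ≤ θ := div_nonneg (by linarith) hden.le
  have hθ1 : θ ≤ 1 := (div_le_one hden).mpr (by linarith)
  have hLθ : L = (1 - θ) * C₁ + θ * C₂ := by rw [hθ]; field_simp; ring
  have hβθ : Real.log β ≤ (1 - θ) * B₁ + θ * B₂ := by
    -- from hch: (log β − B₁)(C₂ − C₁) ≤ (B₂ − B₁)(L − C₁)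
    have h1 : Real.log β - B₁ ≤ (B₂ - B₁) * θ := by
      rw [hθ, mul_div_assoc']
      rw [le_div_iff₀ hden]
      linarith [hch]
    linarith
  calc Real.log β - σ * L ≤ (1 - θ) * B₁ + θ * B₂ - σ * ((1 - θ) * C₁ + θ * C₂) := by rw [← hLθ]; linarith
    _ = (1 - θ) * (B₁ - σ * C₁) + θ * (B₂ - σ * C₂) := by ring
    _ ≤ (1 - θ) * max (B₁ - σ * C₁) (B₂ - σ * C₂) + θ * max (B₁ - σ * C₁) (B₂ - σ * C₂) := by
        have hm1 := mul_le_mul_of_nonneg_left (le_max_left (B₁ - σ * C₁) (B₂ - σ * C₂)) (sub_nonneg.mpr hθ1)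
        have hm2 := mul_le_mul_of_nonneg_left (le_max_right (B₁ - σ * C₁) (B₂ - σ * C₂)) hθ0
        linarith
    _ = max (B₁ - σ * C₁) (B₂ - σ * C₂) := by ring

end Chord

end Summit.ValiantsHypothesis.ValiantsHypothesis.Theorems.LacunarySymmetroidMatrixDescartes.Census.T4
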